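import Literature.MathematicalPhysics.QuantumFieldTheory.Balaban1983to89.B5Eq129FreeResolventDecayedLetter
import Literature.MathematicalPhysics.QuantumFieldTheory.Balaban1983to89.B5Eq129FreeResolventZoneSumLetters
import Literature.MathematicalPhysics.QuantumFieldTheory.Balaban1983to89.B5Eq129CoshSupersolution

/-!
# `Balaban1983to89.B5Eq129FreeResolventDecayedLetterCosh` — T. Bałaban, *Propagators and renormalization transformations for lattice gauge theories. I*, Commun.
# Math. Phys. **95** (1984) 17–40 [Balaban1984PropagatorsI] (1.29) p. 23, Prop. 1.1 p. 33, p. 36, with *Propagators for lattice gauge theories in a background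
# field*, Commun. Math. Phys. **99** (1985) 389–434 [Balaban1985BackgroundPropagators] (3.11) p. 392, Thm 3.1 (3.42) p. 397: **(D-FS) THE DECAYED FREE LETTER
# AT THE DIAGONAL AND WITH THE AGMON `cosh` WEIGHT — `φ_k(x₀) ≤ √(3^d∕(c₁λ^k))·√(Σ_y c₀φ₀(y)²∕W_{x₀}(y))`, `W_{x₀}(y) = Π_μ cosh(a·d_μ(x₀,y))`,
# `λ = 1 − 2d·t²(cosh a − 1) > 0`, `k ≥ d`, `t ≤ N_ν`, `c₀t^d = c₁`: LEVEL-FREE, VOLUME-FREE** — the OWNER's (D-FS) display «`(R^kψ)(x) ≤ C₃′·√(Σ_y c₀e^{−2a·d(x,y)}ψ(y)²)`,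
# `C₃′² = Cλ^{−k}∕c₁`» (plan v10 §5) with the `cosh` weight in place of the exponential (`W_{x₀} ≥ 2^{−d}e^{a·Σ_μ d_μ}`); the instances BY NAME of
# `B5Eq129FreeResolventDecayedLetter.chain_apply_le_weighted` with `B5Eq129FreeResolventZoneSumLetters.entry_const_diag_le` and `B5Eq129CoshSupersolution`

statement-level skeleton of published theorems with citation tags; proofs where landed; nothing here is a claim about the Yang–Mills mass gap

CITATION HEADER (lean-in-tree rule).  Audit cell `pub-balaban`, sub-cell `t4`, BINDER row NE9; filed by NE9 formalisation-swarm LEAF PROVER 02 (lineage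
`b2b-balaban-t4-ne9-formalise-leaf-02`, gen 71) on the row OWNER `t4-ne9-p1` g89's plan v10 §5 (D-FS) (FIRST REFUSAL ne9-leaf-02; journal [NE9LEAF02-G71-OFFER-DFS]).
Sources as in `B5Eq129FreeResolventDecayedLetter` (read first-hand there); the `cosh` supersolution, its positivity and `W_{x₀}(x₀) = 1` are the OWNER's
`B5Eq129CoshSupersolution.weight_supersolution` ∕ `weight_pos` ∕ `weight_factor_centre` BY NAME.  The `[cite: …]` tags are TEXT LOCATIONS only; every statement
is `[folklore]` (ABSOLUTE RULE).

WHAT IS PROVED (sorry-free; 0 `def`; composition BY NAME).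
* **`chain_apply_le_weighted_diag`** — (D-FS) at the diagonal for ANY positive supersolution weight: `φ_k(x₀) ≤ √(3^d∕(c₁λ^k)·W(x₀))·√(Σ_y c₀φ₀(y)²∕W(y))`.
* **`chain_apply_le_cosh`** — general mass `m`, the `cosh` weight centred at `x₀`, `λ = m − 2d·t²(cosh a − 1) > 0` a HYPOTHESIS: `φ_k(x₀) ≤ √(ḡ_k·λ^{−k}∕c₀)·√(Σ_y c₀φ₀²∕W_{x₀})`.
* **`chain_apply_le_cosh_diag`** — the displayed diagonal `cosh` letter.
HONEST SCOPE.  As the two companions: FREE flat Laplacian only; `λ > 0` (the `a`-window) is the instance's hypothesis; nothing of [B9] Thm 3.1 asserted or valued.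
NOT summit progress (cell pub-balaban: NE9 NOT PRINTED ∕ NOT PROVED; «NE9 ⇐ the named binders»; row WALLED ON A MODEL (O-NE9-1; #5 UNRULED); spine PROVED 0∕9;
rung (B)+1 finite T⁴ — NOT infinite volume, NOT mass gap, NOT BetaPertH, NOT Clay).  HONEST DEPENDENCY (cell line): continuum YM on T⁴ ⇐ BetaPertH ∧ nine spine
estimates (0/9 proved); BetaPertH ⇐ (D1) ∧ (D4) ∧ CAP+tail; G-an2-4 gates asym, D1 and NE2/3/4.  NEW file; nothing modified.  Net new unproved facts: 0.
-/

noncomputable section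

open scoped BigOperators ComplexConjugate

namespace Literature.MathematicalPhysics.QuantumFieldTheory.Balaban1983to89.B5Eq129FreeResolventDecayedLetterCosh

open B5Prop11Plancherel (Tor chi unitVec)
open B5Eq129FreeResolventDecayedLetter (chain_apply_le_weighted)
open B5Eq129FreeResolventZoneSumLetters (entry_const_diag_le)
open B4TorusKernel.MultiPeriod (circAbs)
open B5Eq129CoshSupersolution (weight_supersolution weight_pos weight_factor_centre)

variable {d : ℕ} (N : Fin d → ℕ) [hN : ∀ μ, NeZero (N μ)]

/-- **(D-FS) AT THE DIAGONAL** (`m = 1`, `t ≤ N_ν`, `c₀t^d = c₁`, `k ≥ d`), for ANY positive supersolution weight `λW ≤ LW` (`0 < λ`):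
`φ_k(x₀) ≤ √(3^d∕(c₁λ^k)·W(x₀)) · √(Σ_y c₀φ₀(y)²∕W(y))` — LEVEL-FREE, VOLUME-FREE. [cite: Balaban1985BackgroundPropagators, Thm 3.1 (3.42) p.397, (3.11) p.392;
Balaban1984PropagatorsI, (1.29) p.23, Prop. 1.1 p.33] -/
theorem chain_apply_le_weighted_diag {k : ℕ} (hk : d ≤ k) {t c₀ c₁ lam : ℝ} (ht : 0 < t) (hc₀ : 0 < c₀) (hc₁ : c₀ * t ^ d = c₁)
    (hvol : ∀ ν, t ≤ (N ν : ℝ)) (hlam : 0 < lam) {W : Tor N → ℝ} (hW : ∀ y, 0 < W y)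
    (hsup : ∀ y, lam * W y ≤ ∑ ν, t ^ 2 * ((W y - W (y - unitVec N ν)) + (W y - W (y + unitVec N ν))) + 1 * W y)
    {φ : ℕ → Tor N → ℝ}
    (hφ : ∀ j < k, ∀ x, ∑ ν, t ^ 2 * ((φ (j + 1) x - φ (j + 1) (x - unitVec N ν)) + (φ (j + 1) x - φ (j + 1) (x + unitVec N ν))) +
      1 * φ (j + 1) x = φ j x) (x₀ : Tor N) :
    φ k x₀ ≤ Real.sqrt (3 ^ d / (c₁ * lam ^ k) * W x₀) * Real.sqrt (∑ y, c₀ * φ 0 y ^ 2 / W y) := by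
  have h := chain_apply_le_weighted N t one_pos hc₀ hlam hW hsup hφ x₀
  refine h.trans (mul_le_mul_of_nonneg_right (Real.sqrt_le_sqrt ?_) (Real.sqrt_nonneg _))
  have hg := entry_const_diag_le N hk ht hc₀ hc₁ hvol
  have hc₁pos : 0 < c₁ := by rw [← hc₁]; positivity
  have e : (∑ p : Tor N, (((∑ ν, t ^ 2 * (2 - 2 * (chi N p (unitVec N ν)).re)) + 1) ^ k)⁻¹) / Fintype.card (Tor N) *
        (lam ^ k)⁻¹ * W x₀ / c₀ =
      (∑ p : Tor N, (((∑ ν, t ^ 2 * (2 - 2 * (chi N p (unitVec N ν)).re)) + 1) ^ k)⁻¹) / Fintype.card (Tor N) / c₀ *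
        ((lam ^ k)⁻¹ * W x₀) := by ring
  rw [e, show 3 ^ d / (c₁ * lam ^ k) * W x₀ = 3 ^ d / c₁ * ((lam ^ k)⁻¹ * W x₀) by field_simp]
  exact mul_le_mul_of_nonneg_right hg (mul_nonneg (inv_nonneg.2 (pow_nonneg hlam.le k)) (hW x₀).le)

/-- **(D-FS) WITH THE AGMON `cosh` WEIGHT CENTRED AT THE OUTPUT SITE** (`B5Eq129CoshSupersolution`: `W_{x₀}(y) = Π_μ cosh(a·d_μ(x₀,y))` is a supersolution
with `λ = m − 2d·t²(cosh a − 1)`, `W_{x₀}(x₀) = 1`, `W_{x₀} > 0`); `λ > 0` a HYPOTHESIS: `φ_k(x₀) ≤ √(ḡ_k·λ^{−k}∕c₀) · √(Σ_y c₀φ₀(y)²∕W_{x₀}(y))`.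
[cite: Balaban1985BackgroundPropagators, Thm 3.1 (3.42) p.397, (3.11) p.392; Balaban1984PropagatorsI, (1.29) p.23, Prop. 1.1 p.33, p.36] -/
theorem chain_apply_le_cosh (t : ℝ) {m c₀ : ℝ} (a : ℝ) (hm : 0 < m) (hc₀ : 0 < c₀)
    (hlam : 0 < m - 2 * d * t ^ 2 * (Real.cosh a - 1)) {k : ℕ} {φ : ℕ → Tor N → ℝ}
    (hφ : ∀ j < k, ∀ x, ∑ ν, t ^ 2 * ((φ (j + 1) x - φ (j + 1) (x - unitVec N ν)) + (φ (j + 1) x - φ (j + 1) (x + unitVec N ν))) +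
      m * φ (j + 1) x = φ j x) (x₀ : Tor N) :
    φ k x₀ ≤ Real.sqrt ((∑ p : Tor N, (((∑ ν, t ^ 2 * (2 - 2 * (chi N p (unitVec N ν)).re)) + m) ^ k)⁻¹) / Fintype.card (Tor N) *
        ((m - 2 * d * t ^ 2 * (Real.cosh a - 1)) ^ k)⁻¹ / c₀) *
      Real.sqrt (∑ y, c₀ * φ 0 y ^ 2 / ∏ μ, Real.cosh (a * (circAbs (N μ) ((x₀ μ - y μ : ZMod (N μ)).val) : ℝ))) := by
  have h := chain_apply_le_weighted N t hm hc₀ hlam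
    (W := fun y => ∏ μ, Real.cosh (a * (circAbs (N μ) ((x₀ μ - y μ : ZMod (N μ)).val) : ℝ)))
    (fun y => weight_pos N a x₀ y) (fun y => weight_supersolution N a t m x₀ y) hφ x₀
  have h1 : (∏ μ, Real.cosh (a * (circAbs (N μ) ((x₀ μ - x₀ μ : ZMod (N μ)).val) : ℝ))) = 1 :=
    Finset.prod_eq_one fun μ _ => weight_factor_centre N a x₀ μ
  simp only [h1, mul_one] at h
  exact h

/-- **(D-FS) — THE OWNER's DISPLAY** (plan v10 §5: «`(R^kψ)(x) ≤ C₃′·√(Σ_y c₀e^{−2a·d(x,y)}ψ(y)²)`, `C₃′² = Cλ^{−k}∕c₁`», with the `cosh` weight in place of the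
exponential, `W_{x₀} ≥ 2^{−d}e^{a·Σ_μ d_μ}`): at the diagonal (`m = 1`, `t ≤ N_ν`, `c₀t^d = c₁`, `k ≥ d`) and `λ = 1 − 2d·t²(cosh a − 1) > 0`:
`φ_k(x₀) ≤ √(3^d∕(c₁λ^k)) · √(Σ_y c₀φ₀(y)²∕W_{x₀}(y))` — LEVEL-FREE, VOLUME-FREE. [cite: Balaban1985BackgroundPropagators, Thm 3.1 (3.42) p.397, (3.11) p.392;
Balaban1984PropagatorsI, (1.29) p.23, Prop. 1.1 p.33, p.36] -/
theorem chain_apply_le_cosh_diag {k : ℕ} (hk : d ≤ k) {t c₀ c₁ : ℝ} (a : ℝ) (ht : 0 < t) (hc₀ : 0 < c₀) (hc₁ : c₀ * t ^ d = c₁)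
    (hvol : ∀ ν, t ≤ (N ν : ℝ)) (hlam : 0 < 1 - 2 * d * t ^ 2 * (Real.cosh a - 1)) {φ : ℕ → Tor N → ℝ}
    (hφ : ∀ j < k, ∀ x, ∑ ν, t ^ 2 * ((φ (j + 1) x - φ (j + 1) (x - unitVec N ν)) + (φ (j + 1) x - φ (j + 1) (x + unitVec N ν))) +
      1 * φ (j + 1) x = φ j x) (x₀ : Tor N) :
    φ k x₀ ≤ Real.sqrt (3 ^ d / (c₁ * (1 - 2 * d * t ^ 2 * (Real.cosh a - 1)) ^ k)) *
      Real.sqrt (∑ y, c₀ * φ 0 y ^ 2 / ∏ μ, Real.cosh (a * (circAbs (N μ) ((x₀ μ - y μ : ZMod (N μ)).val) : ℝ))) := by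
  have h := chain_apply_le_weighted_diag N hk ht hc₀ hc₁ hvol hlam
    (W := fun y => ∏ μ, Real.cosh (a * (circAbs (N μ) ((x₀ μ - y μ : ZMod (N μ)).val) : ℝ)))
    (fun y => weight_pos N a x₀ y) (fun y => weight_supersolution N a t 1 x₀ y) hφ x₀
  have h1 : (∏ μ, Real.cosh (a * (circAbs (N μ) ((x₀ μ - x₀ μ : ZMod (N μ)).val) : ℝ))) = 1 :=
    Finset.prod_eq_one fun μ _ => weight_factor_centre N a x₀ μ
  simp only [h1, mul_one] at h
  exact h


end Literature.MathematicalPhysics.QuantumFieldTheory.Balaban1983to89.B5Eq129FreeResolventDecayedLetterCosh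

end
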